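import Mathlib.Analysis.Matrix.HermitianFunctionalCalculus
import Mathlib.Data.Real.Sign
import Mathlib.Analysis.SpecialFunctions.Trigonometric.ArctanDeriv
import Mathlib.Analysis.SpecialFunctions.Integrals.Basic
import Mathlib.MeasureTheory.Integral.IntervalIntegral.FundThmCalculus
import Mathlib.MeasureTheory.Integral.Bochner.Basic
import Literature.MathematicalPhysics.QuantumLattice.DuhamelTwoPoint

/-!
# Aizenman–Graf sign-kernel / resolvent bound

Stub `stub_signKernelResolventBound` of the line `weyl-window` (crux `ExtinctionBuildsQCD`,
item stmt-QuantumFields-8968) of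
`Summit.QuantumFields.QCD.Theses.SpectralDefectExtinction.ExtinctionBuildsQCD`.

This is the deterministic heart of the Aizenman–Graf step "fractional-moment bounds on the
resolvent along the imaginary axis imply bounds on the Fermi projector / sign matrix in mean"
(M. Aizenman, G. M. Graf, *Localization bounds for an electron gas*, J. Phys. A 31 (1998)
6783–6806; M. Aizenman, S. Warzel, *Random Operators*, GSM 168, Ch. 13).  For an arbitrary
Hermitian matrix `H` (no invertibility assumption), `Y > 0` and indices `x, y`:

* the trivial entry bound `‖(H - iη)⁻¹ x y‖ ≤ 1/|η|` for `η ≠ 0`;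
* `‖π sgn(H) x y - 2 arctan(H/Y) x y‖ ≤ ∫_{(0,Y]} (‖(H - iη)⁻¹ x y‖ + ‖(H - iη)⁻¹ y x‖) dη`.

Proof: in an eigenbasis `H = U diag(λ) U⋆` everything is a sum over eigenvalues.  The scalar
identity `π sgn t - 2 arctan(t/Y) = ∫₀^Y 2t/(t² + η²) dη` (both sides vanish at `t = 0`, so
zero modes drop out exactly) and `(t - iη)⁻¹ + conj (t - iη)⁻¹ = 2t/(t² + η²)` express the
target entry as `∫_{(0,Y]} ((H - iη)⁻¹ x y + conj ((H - iη)⁻¹ y x)) dη`; the bound is then the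
triangle inequality under the integral.  The entry bound is `‖(λ - iη)⁻¹‖ ≤ 1/|η|` together with
Cauchy–Schwarz on the unit rows of `U`.
-/

noncomputable section

open scoped ComplexConjugate ENNReal
open MeasureTheory Complex Matrix Finset

namespace Summit.QuantumFields.QCD.Cruxes.ExtinctionBuildsQCD.WeylWindow

variable {ι : Type} [Fintype ι] [DecidableEq ι]

/-! ### Conjugated diagonal matrices -/

/-- Entries of `U diag(w) U⋆`: `(U diag(w) U⋆) x y = ∑ᵢ U x i ⋅ conj (U y i) ⋅ wᵢ`. -/
private theorem conj_diagonal_apply (U : Matrix ι ι ℂ) (w : ι → ℂ) (x y : ι) :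
    (U * diagonal w * star U) x y = ∑ i, U x i * star (U y i) * w i := by
  rw [mul_apply]
  refine sum_congr rfl fun i _ => ?_
  rw [mul_diagonal, star_eq_conjTranspose, conjTranspose_apply]
  ring

/-- `conj` of the transposed entry of `U diag(w) U⋆` is the entry of `U diag(conj w) U⋆`. -/
private theorem star_conj_diagonal_apply (U : Matrix ι ι ℂ) (w : ι → ℂ) (x y : ι) :
    star ((U * diagonal w * star U) y x) = ∑ i, U x i * star (U y i) * star (w i) := by
  rw [conj_diagonal_apply, Complex.star_def, map_sum]
  refine sum_congr rfl fun i _ => ?_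
  simp only [map_mul, Complex.conj_conj]
  ring

/-- `U diag(c, …, c) U⋆ = c • 1` for unitary `U`. -/
private theorem conj_diagonal_const {U : Matrix ι ι ℂ} (hU : U ∈ unitary (Matrix ι ι ℂ))
    (c : ℂ) : U * diagonal (fun _ => c) * star U = c • (1 : Matrix ι ι ℂ) := by
  rw [← smul_one_eq_diagonal, Matrix.mul_smul, Matrix.mul_one, Matrix.smul_mul,
    Unitary.mul_star_self_of_mem hU]

/-- `∑ᵢ ‖U x i‖ ‖U y i‖ ≤ 1` for unitary `U` (Cauchy–Schwarz via `2ab ≤ a² + b²` and the unit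
rows of `U`). -/
private theorem sum_norm_mul_norm_le_one {U : Matrix ι ι ℂ} (hU : U ∈ unitary (Matrix ι ι ℂ))
    (x y : ι) : ∑ i, ‖U x i‖ * ‖U y i‖ ≤ 1 := by
  have hx := sum_norm_sq_row_eq_one hU x
  have hy := sum_norm_sq_row_eq_one hU y
  have h : ∀ i ∈ (univ : Finset ι), ‖U x i‖ * ‖U y i‖ ≤ (‖U x i‖ ^ 2 + ‖U y i‖ ^ 2) / 2 := by
    intro i _
    nlinarith [sq_nonneg (‖U x i‖ - ‖U y i‖)]
  calc ∑ i, ‖U x i‖ * ‖U y i‖ ≤ ∑ i, (‖U x i‖ ^ 2 + ‖U y i‖ ^ 2) / 2 := sum_le_sum h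
    _ = 1 := by rw [← sum_div, sum_add_distrib, hx, hy]; norm_num

/-! ### Scalar facts about `(t - iη)⁻¹` and the kernel `2t/(t² + η²)` -/

/-- `‖(t - iη)⁻¹‖ ≤ |η|⁻¹` for real `t` and `η ≠ 0`. -/
private theorem norm_inv_sub_mul_I_le (t : ℝ) {η : ℝ} (hη : η ≠ 0) :
    ‖((t : ℂ) - η * I)⁻¹‖ ≤ |η|⁻¹ := by
  rw [norm_inv]
  apply inv_anti₀ (abs_pos.2 hη)
  have h := abs_im_le_norm ((t : ℂ) - η * I)
  simpa using h

/-- `(t - iη)⁻¹ + conj (t - iη)⁻¹ = 2t/(t² + η²)` (also at `t = η = 0`, where both sides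
are `0`). -/
private theorem inv_add_star_inv (t η : ℝ) :
    ((t : ℂ) - η * I)⁻¹ + star (((t : ℂ) - η * I)⁻¹) = ((2 * t / (t ^ 2 + η ^ 2) : ℝ) : ℂ) := by
  rw [Complex.star_def, Complex.add_conj, Complex.inv_re, Complex.normSq_apply]
  congr 1
  simp
  ring

/-- Continuity of the kernel `η ↦ 2t/(t² + η²)` (identically `0` when `t = 0`). -/
private theorem continuous_kernel (t : ℝ) : Continuous (fun η : ℝ => 2 * t / (t ^ 2 + η ^ 2)) := by
  rcases eq_or_ne t 0 with rfl | ht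
  · simp only [mul_zero, zero_div]
    exact continuous_const
  · refine Continuous.div continuous_const (by fun_prop) fun η => ?_
    positivity

/-- The key scalar identity `∫₀^Y 2t/(t² + η²) dη = π sgn t − 2 arctan (t/Y)` for `Y > 0`:
for `t ≠ 0` the left side is `2 arctan (Y/t)`, and both sides vanish at `t = 0`. -/
private theorem integral_kernel (t : ℝ) {Y : ℝ} (hY : 0 < Y) :
    ∫ η in (0 : ℝ)..Y, 2 * t / (t ^ 2 + η ^ 2) =
      Real.pi * Real.sign t - 2 * Real.arctan (t / Y) := by
  rcases eq_or_ne t 0 with rfl | ht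
  · simp
  · have hderiv : ∀ η ∈ Set.uIcc 0 Y,
        HasDerivAt (fun η => 2 * Real.arctan (η / t)) (2 * t / (t ^ 2 + η ^ 2)) η := by
      intro η _
      refine (((hasDerivAt_id' η).div_const t).arctan.const_mul 2).congr_deriv ?_
      field_simp
    rw [intervalIntegral.integral_eq_sub_of_hasDerivAt hderiv
      ((continuous_kernel t).intervalIntegrable _ _)]
    simp only [zero_div, Real.arctan_zero, mul_zero, sub_zero]
    rw [show Y / t = (t / Y)⁻¹ from (inv_div t Y).symm]
    rcases lt_or_gt_of_ne ht with hneg | hpos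
    · rw [Real.sign_of_neg hneg, Real.arctan_inv_of_neg (div_neg_of_neg_of_pos hneg hY)]
      ring
    · rw [Real.sign_of_pos hpos, Real.arctan_inv_of_pos (div_pos hpos hY)]
      ring

/-! ### The resolvent and the target entry in an eigenbasis -/

variable {H : Matrix ι ι ℂ}

/-- `H - iη = U diag(λᵢ - iη) U⋆`. -/
private theorem sub_smul_one_eq (hH : H.IsHermitian) (η : ℝ) :
    H - ((η : ℂ) * I) • (1 : Matrix ι ι ℂ) = (hH.eigenvectorUnitary : Matrix ι ι ℂ) *
      diagonal (fun i => (hH.eigenvalues i : ℂ) - η * I) *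
        star (hH.eigenvectorUnitary : Matrix ι ι ℂ) := by
  have hU := hH.eigenvectorUnitary.prop
  conv_lhs => rw [hH.eq_conj_diagonal, ← conj_diagonal_const hU ((η : ℂ) * I)]
  rw [← Matrix.sub_mul, ← Matrix.mul_sub, diagonal_sub]

/-- The resolvent at `iη`, `η ≠ 0`, in the eigenbasis: `(H - iη)⁻¹ = U diag((λᵢ - iη)⁻¹) U⋆`
(no invertibility hypothesis on `H`: `λᵢ - iη ≠ 0` since its imaginary part is `-η`). -/
private theorem resolvent_eq (hH : H.IsHermitian) {η : ℝ} (hη : η ≠ 0) :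
    (H - ((η : ℂ) * I) • (1 : Matrix ι ι ℂ))⁻¹ = (hH.eigenvectorUnitary : Matrix ι ι ℂ) *
      diagonal (fun i => ((hH.eigenvalues i : ℂ) - η * I)⁻¹) *
        star (hH.eigenvectorUnitary : Matrix ι ι ℂ) := by
  have hU := hH.eigenvectorUnitary.prop
  have hne : ∀ i, (hH.eigenvalues i : ℂ) - η * I ≠ 0 := by
    intro i h
    have := congrArg Complex.im h
    simp at this
    exact hη this
  apply inv_eq_left_inv
  rw [sub_smul_one_eq hH η]
  set U := (hH.eigenvectorUnitary : Matrix ι ι ℂ)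
  calc U * diagonal (fun i => ((hH.eigenvalues i : ℂ) - η * I)⁻¹) * star U *
        (U * diagonal (fun i => (hH.eigenvalues i : ℂ) - η * I) * star U)
        = U * (diagonal (fun i => ((hH.eigenvalues i : ℂ) - η * I)⁻¹) * (star U * U) *
          diagonal (fun i => (hH.eigenvalues i : ℂ) - η * I)) * star U := by
          simp only [Matrix.mul_assoc]
    _ = 1 := by
          rw [Unitary.star_mul_self_of_mem hU, Matrix.mul_one, diagonal_mul_diagonal]
          have : (fun i => ((hH.eigenvalues i : ℂ) - η * I)⁻¹ * ((hH.eigenvalues i : ℂ) - η * I)) =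
              fun _ => (1 : ℂ) := funext fun i => inv_mul_cancel₀ (hne i)
          rw [this, diagonal_one, Matrix.mul_one, Unitary.mul_star_self_of_mem hU]

/-- The trivial entry bound `‖(H - iη)⁻¹ x y‖ ≤ |η|⁻¹` for `η ≠ 0`. -/
private theorem norm_resolvent_apply_le (hH : H.IsHermitian) {η : ℝ} (hη : η ≠ 0) (x y : ι) :
    ‖(H - ((η : ℂ) * I) • (1 : Matrix ι ι ℂ))⁻¹ x y‖ ≤ |η|⁻¹ := by
  have hU := hH.eigenvectorUnitary.prop
  rw [resolvent_eq hH hη, conj_diagonal_apply]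
  set U := (hH.eigenvectorUnitary : Matrix ι ι ℂ)
  calc ‖∑ i, U x i * star (U y i) * ((hH.eigenvalues i : ℂ) - η * I)⁻¹‖
      ≤ ∑ i, ‖U x i * star (U y i) * ((hH.eigenvalues i : ℂ) - η * I)⁻¹‖ := norm_sum_le _ _
    _ ≤ ∑ i, ‖U x i‖ * ‖U y i‖ * |η|⁻¹ := by
        refine sum_le_sum fun i _ => ?_
        rw [norm_mul, norm_mul, norm_star]
        exact mul_le_mul_of_nonneg_left (norm_inv_sub_mul_I_le _ hη) (by positivity)
    _ = (∑ i, ‖U x i‖ * ‖U y i‖) * |η|⁻¹ := by rw [sum_mul]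
    _ ≤ 1 * |η|⁻¹ := by gcongr; exact sum_norm_mul_norm_le_one hU x y
    _ = |η|⁻¹ := one_mul _

/-- The target entry in the eigenbasis:
`π sgn(H) x y - 2 arctan(H/Y) x y = ∑ᵢ U x i ⋅ conj (U y i) ⋅ (π sgn λᵢ - 2 arctan (λᵢ/Y))`. -/
private theorem target_eq (hH : H.IsHermitian) (Y : ℝ) (x y : ι) :
    (Real.pi : ℂ) * (cfc Real.sign H) x y - 2 * (cfc (fun t : ℝ => Real.arctan (t / Y)) H) x y =
      ∑ i, (hH.eigenvectorUnitary : Matrix ι ι ℂ) x i *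
        star ((hH.eigenvectorUnitary : Matrix ι ι ℂ) y i) *
          ((Real.pi * Real.sign (hH.eigenvalues i) -
            2 * Real.arctan (hH.eigenvalues i / Y) : ℝ) : ℂ) := by
  rw [hH.cfc_eq_conj_diagonal, hH.cfc_eq_conj_diagonal, conj_diagonal_apply,
    conj_diagonal_apply, mul_sum, mul_sum, ← sum_sub_distrib]
  refine sum_congr rfl fun i _ => ?_
  push_cast
  ring

/-- **The sign-kernel / resolvent bound**:
`‖π sgn(H) x y - 2 arctan(H/Y) x y‖ ≤ ∫_{(0,Y]} (‖(H - iη)⁻¹ x y‖ + ‖(H - iη)⁻¹ y x‖) dη`. -/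
private theorem enorm_target_le (hH : H.IsHermitian) {Y : ℝ} (hY : 0 < Y) (x y : ι) :
    ‖(Real.pi : ℂ) * (cfc Real.sign H) x y -
        2 * (cfc (fun t : ℝ => Real.arctan (t / Y)) H) x y‖ₑ ≤
      ∫⁻ η in Set.Ioc (0 : ℝ) Y, (‖(H - ((η : ℂ) * I) • (1 : Matrix ι ι ℂ))⁻¹ x y‖ₑ +
        ‖(H - ((η : ℂ) * I) • (1 : Matrix ι ι ℂ))⁻¹ y x‖ₑ) := by
  set U := (hH.eigenvectorUnitary : Matrix ι ι ℂ) with hUdef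
  set ev := hH.eigenvalues with hev
  -- the integrand in the eigenbasis
  set g : ℝ → ℂ := fun η => ∑ i, U x i * star (U y i) *
    ((2 * ev i / (ev i ^ 2 + η ^ 2) : ℝ) : ℂ) with hg
  have hT : (Real.pi : ℂ) * (cfc Real.sign H) x y -
      2 * (cfc (fun t : ℝ => Real.arctan (t / Y)) H) x y = ∫ η in Set.Ioc 0 Y, g η := by
    rw [target_eq hH Y x y, ← intervalIntegral.integral_of_le hY.le,
      intervalIntegral.integral_finsetSum]
    · refine sum_congr rfl fun i _ => ?_
      rw [intervalIntegral.integral_const_mul, intervalIntegral.integral_ofReal,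
        integral_kernel _ hY]
    · intro i _
      exact ((continuous_ofReal.comp (continuous_kernel (ev i))).intervalIntegrable _ _).const_mul _
  have hgG : ∀ η : ℝ, η ≠ 0 → g η = (H - ((η : ℂ) * I) • (1 : Matrix ι ι ℂ))⁻¹ x y +
      star ((H - ((η : ℂ) * I) • (1 : Matrix ι ι ℂ))⁻¹ y x) := by
    intro η hη
    rw [resolvent_eq hH hη, conj_diagonal_apply, star_conj_diagonal_apply, ← sum_add_distrib]
    refine sum_congr rfl fun i _ => ?_
    rw [← mul_add, inv_add_star_inv]
  rw [hT]
  refine (enorm_integral_le_lintegral_enorm _).trans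
    (setLIntegral_mono' measurableSet_Ioc fun η hη => ?_)
  rw [hgG η (ne_of_gt hη.1)]
  refine (enorm_add_le _ _).trans_eq ?_
  rw [enorm_eq_nnnorm (star _), nnnorm_star, ← enorm_eq_nnnorm]

/-! ### The registered stub -/

/-- **Aizenman–Graf sign-kernel / resolvent bound** (stub `stub_signKernelResolventBound` of the
line `weyl-window`).  For a Hermitian matrix `H`, `Y > 0` and indices `x, y`:
the resolvent entries obey `‖(H - iη)⁻¹ x y‖ ≤ |η|⁻¹` for every real `η ≠ 0`, and the entry of
`π sgn(H) - 2 arctan(H/Y)` at `(x, y)` is bounded by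
`∫_{(0,Y]} (‖(H - iη)⁻¹ x y‖ + ‖(H - iη)⁻¹ y x‖) dη` (as an extended-real Lebesgue integral). -/
theorem stub_signKernelResolventBound :
    ∀ (ι : Type) [Fintype ι] [DecidableEq ι] (H : Matrix ι ι ℂ), H.IsHermitian → ∀ (Y : ℝ), 0 < Y →
      ∀ x y : ι,
        (∀ η : ℝ, η ≠ 0 → ‖(H - ((η : ℂ) * Complex.I) • (1 : Matrix ι ι ℂ))⁻¹ x y‖ ≤ |η|⁻¹) ∧
        ‖(Real.pi : ℂ) * (cfc Real.sign H) x y -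
            2 * (cfc (fun t : ℝ => Real.arctan (t / Y)) H) x y‖ₑ ≤
          ∫⁻ η in Set.Ioc (0 : ℝ) Y, (‖(H - ((η : ℂ) * Complex.I) • (1 : Matrix ι ι ℂ))⁻¹ x y‖ₑ +
            ‖(H - ((η : ℂ) * Complex.I) • (1 : Matrix ι ι ℂ))⁻¹ y x‖ₑ) := by
  intro ι _ _ H hH Y hY x y
  exact ⟨fun η hη => norm_resolvent_apply_le hH hη x y, enorm_target_le hH hY x y⟩

end Summit.QuantumFields.QCD.Cruxes.ExtinctionBuildsQCD.WeylWindow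

end
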